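import Literature.Computability.Complexity.CodeFPArith
import Mathlib.Analysis.SpecialFunctions.Pow.Real
import HarnessLib

/-!
# Stub `stub_schedules` — admissible key-part schedules (crux `WbwObfuscatedGluedTrees`,
# stmt-QuantumAdvantage-2340; line `knowledge-of-walk-split`, stage 3)

The generator of the crux cuts a seed `s ∈ {0,1}ⁿ` into four PRF keys of length `t n` each plus the
obfuscator's coins.  This file proves the schedule arithmetic the master datum needs
(`stub_schedules`): for every obfuscator-parameter polynomial `p` (with `ℓ ≤ p ℓ`) and every polynomial
resource bound `R` there is a key-part schedule `t : ℕ → ℕ` which is unary-polynomial-time computable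
(as is `p ∘ t`), with `n^c ≤ p (t n) ≤ p n` eventually / always, `4 t n ≤ n` always, `R (t n) + 4 t n ≤ n`
eventually and `t → ∞`.

The schedule is `t n = max {j ≤ n | K (j + 1)^m ≤ n}` (`Nat.findGreatest`) for `K = c + 4`, `m = d + 1`,
where `R x ≤ c (x + 1)^d` bounds the resource polynomial by its coefficients.  Every arithmetic clause is
then an instance of the `Nat.findGreatest` API (`findGreatest_spec`, `le_findGreatest`,
`findGreatest_is_greatest`); the lower bound `n ≤ (t n)^{2m}` (maximality) gives `n^{1/(2m)} ≤ t n ≤ p (t n)`.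
Polynomial time in unary is assembled in the typed calculus `CodeFP` (`CodeFP.lean`, `CodeFPArith.lean`):
`t n` in binary is the fold over `[0, …, n]` keeping the last index passing the (binary-arithmetic) test
`K (j + 1)^m ≤ n` (`CodeFP.foldl`, `urange`, `natPow`, `natLe`), converted to unary under the budget `1ⁿ`
(`unOfNatMin`), and `p (t n)` in unary is the brick `Plumb.polyFn p` run on `1^{t n}`.

## References

* S. Arora, B. Barak, *Computational Complexity: A Modern Approach*, CUP 2009, §1.3 (closure of
  polynomial time under composition and polynomially bounded loops; unary inputs) [AroraBarak2009].
-/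

set_option linter.dupNamespace false

namespace Summit.QuantumAdvantage.QuantumAdvantage.Theorems.WbwObfuscatedGluedTrees.KnowledgeOfWalk.Generator

open Literature.Computability.Complexity Filter Polynomial
open Literature.Computability.Complexity.CodeFP (natE unE bitE pairE rawE)

/-! ### Polynomial bookkeeping -/

/-- An `ℕ`-polynomial is below a constant multiple of a power of `x + 1` (bound by the sum of the
coefficients). [folklore] -/
private theorem sched_exists_eval_le (Q : Polynomial ℕ) :
    ∃ c d : ℕ, ∀ x : ℕ, Q.eval x ≤ c * (x + 1) ^ d := by
  refine ⟨∑ i ∈ Finset.range (Q.natDegree + 1), Q.coeff i, Q.natDegree, fun x => ?_⟩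
  rw [eval_eq_sum_range, Finset.sum_mul]
  refine Finset.sum_le_sum fun i hi => ?_
  have hi' : i ≤ Q.natDegree := Nat.lt_succ_iff.1 (Finset.mem_range.1 hi)
  exact Nat.mul_le_mul_left _ ((Nat.pow_le_pow_left (Nat.le_succ x) i).trans
    (Nat.pow_le_pow_right (Nat.succ_pos x) hi'))

/-! ### The schedule `n ↦ max {j ≤ n | K (j + 1)^m ≤ n}`: arithmetic -/

/-- When `K ≤ n` the defining test holds at the schedule value. [folklore] -/
private theorem sched_spec {K m n : ℕ} (hK : K ≤ n) :
    K * (Nat.findGreatest (fun j => K * (j + 1) ^ m ≤ n) n + 1) ^ m ≤ n :=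
  Nat.findGreatest_spec (P := fun j => K * (j + 1) ^ m ≤ n) (Nat.zero_le n) (by simpa using hK)

/-- The keys always fit: `4 · t n ≤ n` (for `K ≥ 4`, `m ≠ 0`). [folklore] -/
private theorem sched_four_mul_le {K m : ℕ} (hK : 4 ≤ K) (hm : m ≠ 0) (n : ℕ) :
    4 * Nat.findGreatest (fun j => K * (j + 1) ^ m ≤ n) n ≤ n := by
  rcases eq_or_ne (Nat.findGreatest (fun j => K * (j + 1) ^ m ≤ n) n) 0 with h0 | h0
  · rw [h0]; exact Nat.zero_le _
  · have hP : K * (Nat.findGreatest (fun j => K * (j + 1) ^ m ≤ n) n + 1) ^ m ≤ n :=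
      Nat.findGreatest_of_ne_zero (P := fun j => K * (j + 1) ^ m ≤ n) rfl h0
    refine le_trans ?_ hP
    calc 4 * Nat.findGreatest (fun j => K * (j + 1) ^ m ≤ n) n
        ≤ 4 * (Nat.findGreatest (fun j => K * (j + 1) ^ m ≤ n) n + 1) := by omega
      _ ≤ K * (Nat.findGreatest (fun j => K * (j + 1) ^ m ≤ n) n + 1) ^ m :=
          Nat.mul_le_mul hK (Nat.le_self_pow hm _)

/-- The resource demand eventually fits: `R (t n) + 4 t n ≤ n` once `n ≥ K = c + 4`. [folklore] -/
private theorem sched_resource_le {R : Polynomial ℕ} {c d : ℕ} (hR : ∀ x, R.eval x ≤ c * (x + 1) ^ d) {n : ℕ}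
    (hn : c + 4 ≤ n) :
    R.eval (Nat.findGreatest (fun j => (c + 4) * (j + 1) ^ (d + 1) ≤ n) n) +
      4 * Nat.findGreatest (fun j => (c + 4) * (j + 1) ^ (d + 1) ≤ n) n ≤ n := by
  have hP := sched_spec (m := d + 1) hn
  generalize Nat.findGreatest (fun j => (c + 4) * (j + 1) ^ (d + 1) ≤ n) n = x at hP ⊢
  have h1 : R.eval x ≤ c * (x + 1) ^ (d + 1) :=
    (hR x).trans (Nat.mul_le_mul_left c (Nat.pow_le_pow_right (Nat.succ_pos x) (Nat.le_succ d)))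
  have h2 : 4 * x ≤ 4 * (x + 1) ^ (d + 1) :=
    Nat.mul_le_mul_left 4 ((Nat.le_succ x).trans (Nat.le_self_pow (Nat.succ_ne_zero d) _))
  calc R.eval x + 4 * x ≤ c * (x + 1) ^ (d + 1) + 4 * (x + 1) ^ (d + 1) := Nat.add_le_add h1 h2
    _ = (c + 4) * (x + 1) ^ (d + 1) := by ring
    _ ≤ n := hP

/-- The schedule is unbounded: `B ≤ t n` once `n ≥ K (B + 1)^m`. [folklore] -/
private theorem sched_le_of_le {K m : ℕ} (hK : 1 ≤ K) (hm : m ≠ 0) {B n : ℕ} (hn : K * (B + 1) ^ m ≤ n) :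
    B ≤ Nat.findGreatest (fun j => K * (j + 1) ^ m ≤ n) n := by
  have hB : B ≤ n :=
    calc B ≤ B + 1 := Nat.le_succ B
      _ ≤ (B + 1) ^ m := Nat.le_self_pow hm _
      _ ≤ K * (B + 1) ^ m := Nat.le_mul_of_pos_left _ hK
      _ ≤ n := hn
  exact Nat.le_findGreatest (P := fun j => K * (j + 1) ^ m ≤ n) hB hn

/-- Maximality: once `t n ≥ 2K`, `n ≤ (t n)^{2m}` (`m = d + 1`). [folklore] -/
private theorem sched_le_pow {K d n : ℕ}
    (hx : 2 * K ≤ Nat.findGreatest (fun j => K * (j + 1) ^ (d + 1) ≤ n) n) (hK : 1 ≤ K) :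
    n ≤ Nat.findGreatest (fun j => K * (j + 1) ^ (d + 1) ≤ n) n ^ (2 * (d + 1)) := by
  have hxn := Nat.findGreatest_le (P := fun j => K * (j + 1) ^ (d + 1) ≤ n) n
  have hmax : ∀ k, Nat.findGreatest (fun j => K * (j + 1) ^ (d + 1) ≤ n) n < k → k ≤ n →
      ¬ K * (k + 1) ^ (d + 1) ≤ n :=
    fun k hk hkn => Nat.findGreatest_is_greatest (P := fun j => K * (j + 1) ^ (d + 1) ≤ n) hk hkn
  generalize Nat.findGreatest (fun j => K * (j + 1) ^ (d + 1) ≤ n) n = x at hxn hmax hx ⊢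
  have h2 : 2 ≤ x := by omega
  rcases hxn.eq_or_lt with hxe | hxl
  · rw [hxe]; exact Nat.le_self_pow (by omega) n
  · have hlt : n < K * (x + 2) ^ (d + 1) := Nat.lt_of_not_le (hmax (x + 1) (Nat.lt_succ_self x) hxl)
    have h3 : (x + 2) ^ (d + 1) ≤ 2 ^ (d + 1) * x ^ (d + 1) := by
      rw [← Nat.mul_pow]; exact Nat.pow_le_pow_left (by omega) _
    have h4 : K * 2 ^ (d + 1) ≤ x ^ (d + 1) := by
      rw [pow_succ, pow_succ]
      calc K * (2 ^ d * 2) = 2 ^ d * (2 * K) := by ring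
        _ ≤ x ^ d * x := Nat.mul_le_mul (Nat.pow_le_pow_left h2 d) hx
    calc n ≤ K * (x + 2) ^ (d + 1) := hlt.le
      _ ≤ K * (2 ^ (d + 1) * x ^ (d + 1)) := Nat.mul_le_mul_left K h3
      _ = K * 2 ^ (d + 1) * x ^ (d + 1) := (Nat.mul_assoc _ _ _).symm
      _ ≤ x ^ (d + 1) * x ^ (d + 1) := Nat.mul_le_mul_right _ h4
      _ = x ^ (2 * (d + 1)) := by rw [← pow_add, two_mul]

/-! ### The schedule in polynomial time on unary numerals -/

/-- A fixed polynomial of a unary numeral, in unary (the brick `Plumb.polyFn`). [cite: AroraBarak2009, §1.3] -/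
private theorem sched_unPoly (q : Polynomial ℕ) : CodeFP unE unE (fun n => q.eval n) :=
  CodeFP.of_fn (Plumb.polyFn q) (Plumb.polyFn_mem_FP q) fun n => by
    rw [Plumb.polyFn_apply, CodeFP.length_unE, CodeFP.unE_eq_ones]

/-- The "keep the last index passing the test" scan over `[0, …, k]` computes `Nat.findGreatest`. [folklore] -/
private theorem sched_foldl_range (P : ℕ → Prop) [DecidablePred P] :
    ∀ k : ℕ, (List.range (k + 1)).foldl (fun b j => if decide (P j) then j else b) 0 = Nat.findGreatest P k
  | 0 => by simp [List.range_succ]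
  | k + 1 => by
    rw [List.range_succ, List.foldl_append, sched_foldl_range P k, List.foldl_cons, List.foldl_nil,
      Nat.findGreatest_succ]
    by_cases h : P (k + 1) <;> simp [h]

/-- The accumulator of the scan is the initial value or an item of the list. [folklore] -/
private theorem sched_foldl_mem {α : Type} (c : α → Bool) (l : List α) :
    ∀ b₀ : α, l.foldl (fun b a => if c a then a else b) b₀ ∈ b₀ :: l := by
  induction l with
  | nil => intro b₀; simp
  | cons a l ih =>
    intro b₀
    rw [List.foldl_cons]
    rcases List.mem_cons.1 (ih (if c a then a else b₀)) with h | h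
    · rw [h]; cases c a <;> simp
    · exact List.mem_cons_of_mem _ (List.mem_cons_of_mem _ h)

/-- **The schedule in binary from `1ⁿ`**: the fold over `[0, …, n]` (budget: the input itself) keeping the
last index `j` with `K (j + 1)^m ≤ n`, all arithmetic in binary. [cite: AroraBarak2009, §1.3] -/
private theorem sched_codeFP_nat (K m : ℕ) :
    CodeFP unE natE (fun n => Nat.findGreatest (fun j => K * (j + 1) ^ m ≤ n) n) := by
  have hN : CodeFP (pairE natE (pairE natE natE)) natE (fun t => t.1) := CodeFP.fst _ _
  have hJ : CodeFP (pairE natE (pairE natE natE)) natE (fun t => t.2.1) := (CodeFP.snd _ _).fst'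
  have hB : CodeFP (pairE natE (pairE natE natE)) natE (fun t => t.2.2) := (CodeFP.snd _ _).snd'
  have hV := CodeFP.natMul.comp ((CodeFP.const (pairE natE (pairE natE natE)) (eβ := natE) K).pair
    (CodeFP.natPow.comp ((CodeFP.natAdd.comp (hJ.pair (CodeFP.const _ (eβ := natE) 1))).pair
      (CodeFP.const _ (eβ := unE) m))))
  have hC := CodeFP.natLe.comp (hV.pair hN)
  have hstep : CodeFP (pairE natE (pairE natE natE)) natE
      (fun t => if decide (K * (t.2.1 + 1) ^ m ≤ t.1) then t.2.1 else t.2.2) :=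
    (hC.ite hJ hB).congr fun t => rfl
  have hfold := CodeFP.foldl (eσ := natE) (eα := natE) (eβ := natE)
    (step := fun n j b => if decide (K * (j + 1) ^ m ≤ n) then j else b) (init := fun _ => (0 : ℕ))
    hstep (CodeFP.const natE 0) X (fun s l₁ l₂ => by
      have hmem := sched_foldl_mem (fun j => decide (K * (j + 1) ^ m ≤ s)) l₁ 0
      simp only [eval_X, CodeFP.pairE_apply, length_boolPair]
      rcases List.mem_cons.1 hmem with h0 | hl
      · rw [h0]; simp
      · have := CodeFP.length_item_le_length_rawE natE (List.mem_append_left l₂ hl)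
        omega)
  refine (hfold.comp (CodeFP.natOfUn.pair (CodeFP.urange.comp CodeFP.unSucc))).congr fun n => ?_
  exact sched_foldl_range (fun j => K * (j + 1) ^ m ≤ n) n

/-- **The schedule in unary from `1ⁿ`** (binary value capped by the budget `1ⁿ`, `t n ≤ n`). [cite: AroraBarak2009, §1.3] -/
private theorem sched_codeFP_un (K m : ℕ) :
    CodeFP unE unE (fun n => Nat.findGreatest (fun j => K * (j + 1) ^ m ≤ n) n) :=
  (CodeFP.unOfNatMin.comp ((CodeFP.id unE).pair (sched_codeFP_nat K m))).congr fun n =>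
    min_eq_left (Nat.findGreatest_le n)

/-! ### The stub -/

/-- **Admissible schedules.**  For every polynomial obfuscator-parameter schedule `p` (with `ℓ ≤ p ℓ`) and
every polynomial resource bound `R` there is a key-part schedule `t` (unary-poly-time, as is `p ∘ t`) with
`n^c ≤ p (t n) ≤ poly(n)`, `4 t n ≤ n`, `R (t n) + 4 t n ≤ n` eventually, and `t → ∞`; here
`t n = max {j ≤ n | (c + 4) (j + 1)^{d+1} ≤ n}` for `R x ≤ c (x + 1)^d`. [cite: AroraBarak2009, §1.3] -/
theorem stub_schedules :
    ∀ (p R : Polynomial ℕ), (∀ ℓ, ℓ ≤ p.eval ℓ) →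
      ∃ t : ℕ → ℕ,
        PolyTimeComputable Computability.unaryEncodeNat Computability.unaryEncodeNat t ∧
        PolyTimeComputable Computability.unaryEncodeNat Computability.unaryEncodeNat (fun n => p.eval (t n)) ∧
        (∃ c : ℝ, 0 < c ∧ ∀ᶠ n : ℕ in atTop, (n : ℝ) ^ c ≤ ((p.eval (t n) : ℕ) : ℝ)) ∧
        (∃ p' : Polynomial ℕ, ∀ n, p.eval (t n) ≤ p'.eval n) ∧
        (∀ n, 4 * t n ≤ n) ∧
        (∃ n₀ : ℕ, ∀ n, n₀ ≤ n → R.eval (t n) + 4 * t n ≤ n) ∧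
        (∀ B : ℕ, ∃ n₀ : ℕ, ∀ n, n₀ ≤ n → B ≤ t n) := by
  intro p R hp
  obtain ⟨c, d, hR⟩ := sched_exists_eval_le R
  have hK : 1 ≤ c + 4 := by omega
  have hT := sched_codeFP_un (c + 4) (d + 1)
  -- unboundedness, used twice
  have hunb : ∀ B : ℕ, ∃ n₀ : ℕ, ∀ n, n₀ ≤ n →
      B ≤ Nat.findGreatest (fun j => (c + 4) * (j + 1) ^ (d + 1) ≤ n) n :=
    fun B => ⟨(c + 4) * (B + 1) ^ (d + 1), fun n hn => sched_le_of_le hK (Nat.succ_ne_zero d) hn⟩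
  refine ⟨fun n => Nat.findGreatest (fun j => (c + 4) * (j + 1) ^ (d + 1) ≤ n) n, hT.polyTimeComputable,
    ((sched_unPoly p).comp hT).polyTimeComputable, ?_, ⟨p, fun n => TM2Iter.eval_mono p (Nat.findGreatest_le n)⟩,
    fun n => sched_four_mul_le (by omega) (Nat.succ_ne_zero d) n, ⟨c + 4, fun n hn => sched_resource_le hR hn⟩,
    hunb⟩
  -- the polynomial lower bound `n^{1/(2m)} ≤ t n ≤ p (t n)`
  obtain ⟨n₁, hn₁⟩ := hunb (2 * (c + 4))
  refine ⟨((2 * (d + 1) : ℕ) : ℝ)⁻¹, inv_pos.2 (Nat.cast_pos.2 (by omega)), ?_⟩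
  filter_upwards [eventually_ge_atTop n₁] with n hn
  have hle := sched_le_pow (hn₁ n hn) hK
  generalize Nat.findGreatest (fun j => (c + 4) * (j + 1) ^ (d + 1) ≤ n) n = x at hle ⊢
  have hcast : (n : ℝ) ≤ (x : ℝ) ^ (2 * (d + 1)) := by exact_mod_cast hle
  calc (n : ℝ) ^ ((2 * (d + 1) : ℕ) : ℝ)⁻¹ ≤ ((x : ℝ) ^ (2 * (d + 1))) ^ ((2 * (d + 1) : ℕ) : ℝ)⁻¹ :=
      Real.rpow_le_rpow (Nat.cast_nonneg n) hcast (inv_nonneg.2 (Nat.cast_nonneg _))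
    _ = (x : ℝ) := Real.pow_rpow_inv_natCast (Nat.cast_nonneg _) (by omega)
    _ ≤ ((p.eval x : ℕ) : ℝ) := by exact_mod_cast hp x

end Summit.QuantumAdvantage.QuantumAdvantage.Theorems.WbwObfuscatedGluedTrees.KnowledgeOfWalk.Generator
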